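import Literature.NumberTheory.Automorphic.AdelicGroupDataAutomorphicMeasureProofs
import Literature.NumberTheory.Automorphic.AdelicGroupDataUniquenessProofs
import HarnessLib

/-!
# Integrals over the automorphic quotient of `GL_n` are dominated by integrals over a Siegel set

Topic `NumberTheory/Automorphic`; namespace `Literature.NumberTheory.Automorphic`. Proof file
(theorems only). For the Rankin–Selberg integrals `∫ |φ|² E(·, Φ, σ) dμ` over the automorphic
quotient `GL_n((AdeleRing (𝓞 K) K)_K) ⧸ A_G GL_n(K)` (Jacquet–Shalika (1981), §4; Cogdell (2004), §2.3) one bounds the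
quotient integral by an integral over a Siegel set, where the rapid decay of cusp forms and the
moderate growth of Eisenstein series are stated. On the tree's axiomatic automorphic measures
(`AdelicGroupData.IsAutomorphicMeasure`: finite, positive on opens, inner regular, invariant) this
is the content of the construction of `AdelicGroupDataAutomorphicMeasureProofs` (the automorphic
measure as the image of Haar measure restricted to a fundamental domain in the norm band, covered
by the `GL_n(K)`-translates of an inverted thickened Siegel set — reduction theory
`reductionTheory_gl_holds`) together with the uniqueness of automorphic measures up to a scalar
(`isAutomorphicMeasure_unique_smul_holds`):

* `exists_isAutomorphicMeasure_gl_lintegral_le` — the construction, replayed, with the extra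
  conclusion `∫ f dν ≤ ∫_{Z Ω A_{T₀}(t) K} f([g⁻¹]) dμ_Haar(g)` for every `f ≥ 0` (no measurability
  needed: `lintegral_map_le`)
  (`Z ⊆ A_G` compact, `Ω ⊆ B((AdeleRing (𝓞 K) K)_K)` compact, `t > 0`);
* `exists_lintegral_le_mul_setLIntegral_siegel` — **for every automorphic measure `μ'` and every
  Haar measure `μ` on `GL_n((AdeleRing (𝓞 K) K)_K)`** there are such Siegel data and `c < ∞` with
  `∫ f dμ' ≤ c ∫_{Z Ω A_{T₀}(t) K} f([g⁻¹]) dμ(g)` for all `f ≥ 0`.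

Here `[g] = toAutomorphicQuotient g` and `f([g⁻¹])` is the classical left-`GL_n(K)`-invariant
function attached to `f` (the tree's `invQuot` dictionary). Folklore (Borel (1963), §5; Godement,
Sém. Bourbaki 257, §8; Getz–Hahn (2024), Thm. 2.6.2).

## References

* A. Borel, *Some finiteness properties of adele groups over number fields*, Publ. Math. IHÉS 16
  (1963), §5, Thm. 5.8 [Borel1963].
* J. R. Getz, H. Hahn, *An Introduction to Automorphic Representations* (2024), Thm. 2.6.2,
  Thm. 2.7.2 [GetzHahn2024].
-/

noncomputable section

open MeasureTheory Measure NumberField IsDedekindDomain Matrix Set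
open scoped MatrixGroups NNReal ENNReal Pointwise

namespace Literature.NumberTheory.Automorphic

section Domination

variable (n : ℕ) (K : Type) [Field K] [NumberField K]

attribute [local instance] glAdeleBorel borelSpace_glAdele

/-- **The automorphic measure of the construction is dominated by the Siegel-set integral.** For a
Haar measure `μ` on `GL_n((AdeleRing (𝓞 K) K)_K)` there are an automorphic measure `ν` on the quotient
`GL_n((AdeleRing (𝓞 K) K)_K) ⧸ A_G GL_n(K)` and Siegel data `t > 0`, `Ω ⊆ B((AdeleRing (𝓞 K) K)_K)` compact, `Z ⊆ A_G` compact, with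
`∫ f dν ≤ ∫_{Z · Ω · A_{T₀}(t) · K} f([g⁻¹]) dμ(g)` for every `f : X → [0, ∞]` (measurable or not).
The measure is the
one of `AdelicGroupData.exists_isAutomorphicMeasure_gl_holds` (image of `μ|_{F ∩ D}`, `F` a
fundamental domain for `GL_n(K)` acting on the right, `D` the norm band), whose construction is
replayed verbatim; the inequality: `F ∩ D ⊆ ⋃_γ F ∩ R γ` with `R = (Z Ω A_{T₀}(t) K)⁻¹`
(`normBand_subset_iUnion_smul`), `∫_{F ∩ Rγ} = ∫_{Fγ⁻¹ ∩ R}` (right invariance of `μ` and of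
`g ↦ [g]` under `GL_n(K)`), `∑_γ ∫_{R ∩ Fγ} = ∫_R` (`F` is a fundamental domain), and inversion.
[cite: Borel1963, Thm. 5.8] -/
theorem exists_isAutomorphicMeasure_gl_lintegral_le (μ : Measure (GL (Fin n) (AdeleRing (𝓞 K) K))) [μ.IsHaarMeasure] :
    ∃ (ν : Measure (AdelicGroupData.gl n K).automorphicQuotient) (Ω : Set (GL (Fin n) (AdeleRing (𝓞 K) K))) (t : ℝ)
      (Z : Set (GL (Fin n) (AdeleRing (𝓞 K) K))), (AdelicGroupData.gl n K).IsAutomorphicMeasure ν ∧ 0 < t ∧ IsCompact Ω ∧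
      Ω ⊆ (standardParabolicGL (AdeleRing (𝓞 K) K) (id : Fin n → Fin n) : Set (GL (Fin n) (AdeleRing (𝓞 K) K))) ∧
      IsCompact Z ∧ Z ⊆ Set.range (posRealScalar n K) ∧
      ∀ f : (AdelicGroupData.gl n K).automorphicQuotient → ℝ≥0∞,
        ∫⁻ x, f x ∂ν ≤ ∫⁻ g in Z * (Ω * siegelCone n K t *
            (standardMaximalCompactGL n K : Set (GL (Fin n) (AdeleRing (𝓞 K) K)))),
          f ((AdelicGroupData.gl n K).toAutomorphicQuotient g⁻¹) ∂μ := by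
  classical
  haveI : T2Space (GL (Fin n) (AdeleRing (𝓞 K) K)) := t2Space_gl n K
  haveI : LocallyCompactSpace (GL (Fin n) (AdeleRing (𝓞 K) K)) :=
    AdelicGroupData.locallyCompactSpace_generalLinearGroup_adeleRing K (Fin n)
  haveI : SecondCountableTopology (GL (Fin n) (AdeleRing (𝓞 K) K)) :=
    secondCountableTopology_generalLinearGroup_adeleRing K (Fin n)
  -- the Haar measure: left and right invariant, inversion invariant
  haveI : μ.IsMulRightInvariant :=
    GLn.isMulRightInvariant_of_isHaarMeasure_adelic_holds n K μ (inferInstance : μ.IsHaarMeasure)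
  haveI : μ.IsInvInvariant := isInvInvariant_of_isMulRightInvariant μ
  -- the discrete countable subgroup `Γ = GL_n(K)` and a fundamental domain for its right action
  haveI : DiscreteTopology ↥(rationalPointsGL n K) := gl_isDiscreteRational_holds n K
  haveI : Countable ↥(rationalPointsGL n K) := countable_rationalPointsGL n K
  haveI : Countable ↥(rationalPointsGL n K).op :=
    Countable.of_equiv _ (Subgroup.equivOp (rationalPointsGL n K))
  obtain ⟨F, hFm, hF⟩ :=
    Literature.MeasureTheory.Group.Subgroup.exists_isFundamentalDomain_op_of_discrete
      (rationalPointsGL n K) μ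
  -- the norm band `D` and the finiteness of `μ (F ∩ D)`
  obtain ⟨Ω, t, Z, ht, hΩc, hΩB, hZc, hZr, hDsub⟩ := normBand_subset_iUnion_smul n K
  set D : Set (GL (Fin n) (AdeleRing (𝓞 K) K)) := normBand n K with hD
  have hDm : MeasurableSet D := (isClosed_normBand n K).measurableSet
  set S : Set (GL (Fin n) (AdeleRing (𝓞 K) K)) :=
    Z * (Ω * siegelCone n K t * (standardMaximalCompactGL n K : Set (GL (Fin n) (AdeleRing (𝓞 K) K)))) with hS
  set R : Set (GL (Fin n) (AdeleRing (𝓞 K) K)) := S⁻¹ with hR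
  have hRfin : μ R < ⊤ := by
    rw [hR, measure_inv, hS]
    exact measure_mul_siegelSet_lt_top μ hΩc hΩB ht hZc hZr
  have hFD : μ (F ∩ D) < ⊤ := by
    calc μ (F ∩ D) ≤ μ (F ∩ ⋃ γ : ↥(rationalPointsGL n K).op, γ • R) :=
          measure_mono (inter_subset_inter_right _ hDsub)
      _ = μ (⋃ γ : ↥(rationalPointsGL n K).op, F ∩ γ • R) := by rw [inter_iUnion]
      _ ≤ ∑' γ : ↥(rationalPointsGL n K).op, μ (F ∩ γ • R) := measure_iUnion_le _
      _ = ∑' γ : ↥(rationalPointsGL n K).op, μ (R ∩ γ⁻¹ • F) := by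
          congr 1; funext γ
          have hγ : γ⁻¹ • (F ∩ γ • R) = γ⁻¹ • F ∩ R := by
            rw [Set.smul_set_inter, inv_smul_smul]
          rw [← MeasureTheory.measure_smul (μ := μ) (c := γ⁻¹) (s := F ∩ γ • R), hγ, Set.inter_comm]
      _ = ∑' γ : ↥(rationalPointsGL n K).op, μ (R ∩ γ • F) :=
          (Equiv.inv ↥(rationalPointsGL n K).op).tsum_eq fun γ => μ (R ∩ γ • F)
      _ = μ R := (hF.measure_eq_tsum' R).symm
      _ < ⊤ := hRfin
  -- the quotient map and the candidate measure
  set π : GL (Fin n) (AdeleRing (𝓞 K) K) → (AdelicGroupData.gl n K).automorphicQuotient :=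
    (AdelicGroupData.gl n K).toAutomorphicQuotient with hπ
  have hπc : Continuous π := (AdelicGroupData.gl n K).continuous_toAutomorphicQuotient
  have hπm : Measurable π := hπc.measurable
  set ν : Measure (AdelicGroupData.gl n K).automorphicQuotient :=
    Measure.map π (μ.restrict (F ∩ D)) with hν
  have hν_apply : ∀ A, MeasurableSet A → ν A = μ (π ⁻¹' A ∩ (F ∩ D)) := fun A hA => by
    rw [hν, Measure.map_apply hπm hA, Measure.restrict_apply (hπm hA)]
  -- invariance of preimages under `Γ` (on the right) and of `D`
  have hinvΓ : ∀ (A : Set (AdelicGroupData.gl n K).automorphicQuotient)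
      (γ : ↥(rationalPointsGL n K).op), (fun x => γ • x) ⁻¹' (π ⁻¹' A ∩ D) = π ⁻¹' A ∩ D := by
    intro A γ
    have hγ : MulOpposite.unop (γ : (GL (Fin n) (AdeleRing (𝓞 K) K))ᵐᵒᵖ) ∈ rationalPointsGL n K :=
      Subgroup.mem_op.1 γ.2
    ext x
    change (π (x * MulOpposite.unop (γ : (GL (Fin n) (AdeleRing (𝓞 K) K))ᵐᵒᵖ)) ∈ A ∧
      x * MulOpposite.unop (γ : (GL (Fin n) (AdeleRing (𝓞 K) K))ᵐᵒᵖ) ∈ D) ↔ (π x ∈ A ∧ x ∈ D)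
    rw [hπ, toAutomorphicQuotient_mul_of_mem_rationalPointsGL n K x hγ, hD,
      mul_mem_normBand_iff hγ]
  -- finiteness
  have hfin : IsFiniteMeasure ν := by
    refine ⟨?_⟩
    rw [hν_apply _ MeasurableSet.univ, Set.preimage_univ, Set.univ_inter]
    exact hFD
  -- invariance under `GL_n((AdeleRing (𝓞 K) K)_K)`
  have hinv : SMulInvariantMeasure (AdelicGroupData.gl n K).Adelic
      (AdelicGroupData.gl n K).automorphicQuotient ν := by
    refine ⟨fun c A hA => ?_⟩
    have hcA : MeasurableSet ((fun y => c • y) ⁻¹' A) := measurable_const_smul c hA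
    rw [hν_apply _ hcA, hν_apply _ hA]
    -- view `c` as an element of `GL (Fin n) (AdeleRing (𝓞 K) K)`
    obtain ⟨cG, hcG⟩ : ∃ cG : GL (Fin n) (AdeleRing (𝓞 K) K), cG = c := ⟨c, rfl⟩
    subst c
    change μ ((fun x : GL (Fin n) (AdeleRing (𝓞 K) K) => π (cG * x)) ⁻¹' A ∩ (F ∩ D)) = μ (π ⁻¹' A ∩ (F ∩ D))
    -- the central element of the same absolute determinant
    obtain ⟨r, hr⟩ := exists_glAbsDet_posRealScalar_eq n K cG
    set z : GL (Fin n) (AdeleRing (𝓞 K) K) := posRealScalar n K r with hz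
    have hzπ : ∀ y : GL (Fin n) (AdeleRing (𝓞 K) K), π (z⁻¹ * y) = π y := fun y => by
      rw [show z⁻¹ = posRealScalar n K r⁻¹ by rw [hz, map_inv]]
      exact toAutomorphicQuotient_posRealScalar_mul n K y r⁻¹
    -- the set identity
    set W : Set (GL (Fin n) (AdeleRing (𝓞 K) K)) := π ⁻¹' A ∩ D with hW
    have hWm : MeasurableSet W := (hπm hA).inter hDm
    have hset : (fun x : GL (Fin n) (AdeleRing (𝓞 K) K) => π (cG * x)) ⁻¹' A ∩ (F ∩ D) =
        (fun x => (z⁻¹ * cG) * x) ⁻¹' (W ∩ (z⁻¹ * cG) • F) := by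
      have hcD : cG • D = z • D := by rw [hD]; exact smul_normBand_eq hr
      ext x
      simp only [Set.mem_preimage, Set.mem_inter_iff, hW]
      constructor
      · rintro ⟨hxA, hxF, hxD⟩
        refine ⟨⟨?_, ?_⟩, ?_⟩
        · rw [mul_assoc, hzπ]; exact hxA
        · -- `z⁻¹ c x ∈ D ↔ c x ∈ z D = c D ↔ x ∈ D`
          have h2 : cG * x ∈ z • D := by rw [← hcD]; exact Set.smul_mem_smul_set hxD
          rw [mul_assoc]
          exact Set.mem_smul_set_iff_inv_smul_mem.1 h2
        · exact Set.smul_mem_smul_set hxF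
      · rintro ⟨⟨hxA, hxD⟩, hxF⟩
        refine ⟨?_, ?_, ?_⟩
        · rw [mul_assoc, hzπ] at hxA; exact hxA
        · exact (Set.smul_mem_smul_set_iff.1 hxF)
        · have h2 : cG * x ∈ z • D := by
            refine Set.mem_smul_set_iff_inv_smul_mem.2 ?_
            rw [smul_eq_mul, ← mul_assoc]; exact hxD
          rw [← hcD] at h2
          exact Set.smul_mem_smul_set_iff.1 h2
    rw [hset, measure_preimage_mul]
    -- change of fundamental domain
    have hF' : IsFundamentalDomain (↥(rationalPointsGL n K).op) ((z⁻¹ * cG) • F) μ :=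
      hF.smul_of_comm (z⁻¹ * cG)
    rw [hF'.measure_set_eq hF hWm (hinvΓ A), hW, Set.inter_assoc, Set.inter_comm D F]
  -- positivity on non-empty open sets
  have hpos : ν.IsOpenPosMeasure := by
    refine ⟨fun U hU hne => ?_⟩
    rw [hν_apply _ hU.measurableSet]
    obtain ⟨u, hu⟩ := hne
    obtain ⟨x, rfl⟩ := QuotientGroup.mk_surjective u
    obtain ⟨xG, hxG⟩ : ∃ xG : GL (Fin n) (AdeleRing (𝓞 K) K), xG = x := ⟨x, rfl⟩
    subst x
    obtain ⟨r, hr⟩ := exists_glAbsDet_mul_posRealScalar_eq_one n K xG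
    set x' : GL (Fin n) (AdeleRing (𝓞 K) K) := xG * posRealScalar n K r with hx'
    have hx'U : π x' ∈ U := by
      have : π x' = π xG := by
        rw [hx', Subgroup.mem_center_iff.1 (posRealScalar_mem_center n K r) xG]
        exact toAutomorphicQuotient_posRealScalar_mul n K xG r
      rw [this]; exact hu
    set O : Set (GL (Fin n) (AdeleRing (𝓞 K) K)) := π ⁻¹' U ∩
      ((fun g => ((glAbsDet n K g : ℝ≥0) : ℝ)) ⁻¹' Set.Ioo (1 / 2) 2) with hO
    have hOo : IsOpen O :=
      (hU.preimage hπc).inter (isOpen_Ioo.preimage (continuous_glAbsDet_real n K))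
    have hx'O : x' ∈ O := by
      refine ⟨hx'U, ?_⟩
      change ((glAbsDet n K x' : ℝ≥0) : ℝ) ∈ Set.Ioo (1 / 2 : ℝ) 2
      rw [hx', hr, Units.val_one, NNReal.coe_one]
      norm_num
    have hOpos : 0 < μ O := hOo.measure_pos μ ⟨x', hx'O⟩
    set W : Set (GL (Fin n) (AdeleRing (𝓞 K) K)) := π ⁻¹' U ∩ D with hW
    have hWm : MeasurableSet W := (hπm hU.measurableSet).inter hDm
    have hOW : O ⊆ W := fun y hy => ⟨hy.1, ⟨hy.2.1.le, hy.2.2.le⟩⟩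
    have hWsum : μ W = ∑' γ : ↥(rationalPointsGL n K).op, μ (W ∩ F) := by
      rw [hF.measure_eq_tsum W]
      congr 1; funext γ
      have hγW : γ • W = W := by
        have h := hinvΓ U γ⁻¹
        rwa [Set.preimage_smul, inv_inv] at h
      rw [hγW]
    intro h0
    have hWF : μ (W ∩ F) = 0 := by rw [hW, Set.inter_assoc, Set.inter_comm D F]; exact h0
    have hW0 : μ W = 0 := by rw [hWsum, hWF, tsum_zero]
    exact (hOpos.trans_le (measure_mono hOW)).ne' hW0
  -- inner regularity: image of a finite regular measure under a continuous map
  haveI : IsFiniteMeasure (μ.restrict (F ∩ D)) :=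
    ⟨by rw [Measure.restrict_apply_univ]; exact hFD⟩
  have hreg : ν.InnerRegularCompactLTTop := by
    rw [hν]
    exact Measure.InnerRegularCompactLTTop.map_of_continuous hπc
  -- the domination by the Siegel-set integral
  have hle : ∀ f : (AdelicGroupData.gl n K).automorphicQuotient → ℝ≥0∞,
      ∫⁻ x, f x ∂ν ≤ ∫⁻ g in S, f (π g⁻¹) ∂μ := by
    intro f
    have hΓinv : ∀ (γ : ↥(rationalPointsGL n K).op) (a : GL (Fin n) (AdeleRing (𝓞 K) K)), π (γ • a) = π a := by
      intro γ a
      have hγ : MulOpposite.unop (γ : (GL (Fin n) (AdeleRing (𝓞 K) K))ᵐᵒᵖ) ∈ rationalPointsGL n K :=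
        Subgroup.mem_op.1 γ.2
      exact toAutomorphicQuotient_mul_of_mem_rationalPointsGL n K a hγ
    calc ∫⁻ x, f x ∂ν ≤ ∫⁻ g, f (π g) ∂(μ.restrict (F ∩ D)) := by rw [hν]; exact lintegral_map_le f π
      _ ≤ ∫⁻ g in F ∩ ⋃ γ : ↥(rationalPointsGL n K).op, γ • R, f (π g) ∂μ :=
          lintegral_mono_set (inter_subset_inter_right _ hDsub)
      _ = ∫⁻ g in ⋃ γ : ↥(rationalPointsGL n K).op, (F ∩ γ • R), f (π g) ∂μ := by rw [inter_iUnion]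
      _ ≤ ∑' γ : ↥(rationalPointsGL n K).op, ∫⁻ g in F ∩ γ • R, f (π g) ∂μ := lintegral_iUnion_le _ _
      _ = ∑' γ : ↥(rationalPointsGL n K).op, ∫⁻ g in R ∩ γ⁻¹ • F, f (π g) ∂μ := by
          refine tsum_congr fun γ => ?_
          have h := (measurePreserving_smul γ μ).setLIntegral_comp_preimage_emb
            (measurableEmbedding_const_smul γ) (fun g => f (π g)) (F ∩ γ • R)
          have hpre : (fun x : GL (Fin n) (AdeleRing (𝓞 K) K) => γ • x) ⁻¹' (F ∩ γ • R) = R ∩ γ⁻¹ • F := by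
            rw [Set.preimage_inter, Set.preimage_smul, Set.preimage_smul, inv_smul_smul, Set.inter_comm]
          rw [← h, hpre]
          refine lintegral_congr fun a => ?_
          simp only [hΓinv]
      _ = ∑' γ : ↥(rationalPointsGL n K).op, ∫⁻ g in R ∩ γ • F, f (π g) ∂μ :=
          (Equiv.inv ↥(rationalPointsGL n K).op).tsum_eq fun γ => ∫⁻ g in R ∩ γ • F, f (π g) ∂μ
      _ = ∫⁻ g in R, f (π g) ∂μ := (hF.setLIntegral_eq_tsum _ _).symm
      _ = ∫⁻ g in S, f (π g⁻¹) ∂μ := by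
          have h := (Measure.measurePreserving_inv μ).setLIntegral_comp_preimage_emb
            (MeasurableEquiv.inv (GL (Fin n) (AdeleRing (𝓞 K) K))).measurableEmbedding (fun g => f (π g⁻¹)) S
          rw [← h, hR, Set.inv_preimage]
          refine lintegral_congr fun a => ?_
          simp only [inv_inv]
  have hAut : (AdelicGroupData.gl n K).IsAutomorphicMeasure ν := by
    haveI := hfin; haveI := hpos; haveI := hreg; haveI := hinv
    constructor
  exact ⟨ν, Ω, t, Z, hAut, ht, hΩc, hΩB, hZc, hZr, hle⟩


/-- **Every automorphic measure is dominated by a Siegel-set integral.** For an automorphic measure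
`μ'` on `GL_n((AdeleRing (𝓞 K) K)_K) ⧸ A_G GL_n(K)` and a Haar measure `μ` on `GL_n((AdeleRing (𝓞 K) K)_K)` there are Siegel data
`t > 0`, `Ω ⊆ B((AdeleRing (𝓞 K) K)_K)` compact, `Z ⊆ A_G` compact and a constant `c < ∞` with
`∫ f dμ' ≤ c · ∫_{Z · Ω · A_{T₀}(t) · K} f([g⁻¹]) dμ(g)` for every `f : X → [0, ∞]`
(`exists_isAutomorphicMeasure_gl_lintegral_le` and the uniqueness of automorphic measures up to a
positive scalar, `isAutomorphicMeasure_unique_smul_holds`). [cite: Borel1963, §5] -/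
theorem exists_lintegral_le_mul_setLIntegral_siegel
    (μ' : Measure (AdelicGroupData.gl n K).automorphicQuotient) [(AdelicGroupData.gl n K).IsAutomorphicMeasure μ']
    (μ : Measure (GL (Fin n) (AdeleRing (𝓞 K) K))) [μ.IsHaarMeasure] :
    ∃ (c : ℝ≥0∞) (Ω : Set (GL (Fin n) (AdeleRing (𝓞 K) K))) (t : ℝ) (Z : Set (GL (Fin n) (AdeleRing (𝓞 K) K))), c ≠ ⊤ ∧ 0 < t ∧ IsCompact Ω ∧
      Ω ⊆ (standardParabolicGL (AdeleRing (𝓞 K) K) (id : Fin n → Fin n) : Set (GL (Fin n) (AdeleRing (𝓞 K) K))) ∧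
      IsCompact Z ∧ Z ⊆ Set.range (posRealScalar n K) ∧
      ∀ f : (AdelicGroupData.gl n K).automorphicQuotient → ℝ≥0∞,
        ∫⁻ x, f x ∂μ' ≤ c * ∫⁻ g in Z * (Ω * siegelCone n K t *
            (standardMaximalCompactGL n K : Set (GL (Fin n) (AdeleRing (𝓞 K) K)))),
          f ((AdelicGroupData.gl n K).toAutomorphicQuotient g⁻¹) ∂μ := by
  obtain ⟨ν, Ω, t, Z, hAut, ht, hΩc, hΩB, hZc, hZr, hle⟩ :=
    exists_isAutomorphicMeasure_gl_lintegral_le n K μ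
  haveI := hAut
  obtain ⟨c, hc0, hceq⟩ := AdelicGroupData.isAutomorphicMeasure_unique_smul_holds n K μ' ν
  refine ⟨(c : ℝ≥0∞), Ω, t, Z, ENNReal.coe_ne_top, ht, hΩc, hΩB, hZc, hZr, fun f => ?_⟩
  rw [hceq, lintegral_smul_measure]
  exact mul_le_mul' le_rfl (hle f)

end Domination

end Literature.NumberTheory.Automorphic
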